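import Summits.CriticalPhenomena.PercolationContinuityZ3.Theorems.Transplant.SkelFrmBChoiceRootClearR
import HarnessLib

/-!
# N2 (frames-only node `SamePDropOfSkeletonFrm₁`, OPEN), (R) column SECOND axis — **THE SEED CLEARANCE `hclear₃` OF THE ROOT'S y′-CORRIDOR AT THE
# WIDE WINDOW**: `KS.hclear₃_RW` = `KS.hclear₃_R` (SkelFrmBChoiceRootClearR, p365911) with the (C)-value row `kgXY …(kgNYv0) ≤ 19·sL` RELAXED to
# `kgXY …(kgNYv0) ≤ 100·sL`

Why: stmt-g22's era-3 window `q_Y = P + 19·sL + 42` gives `kgXY … ≤ 22·sL` (`NegB.XY_le_3`, SkelFrmBChoiceCreepY3), not `19·sL` (lane INBOX 16:17:05Z);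
the clearance budget of `hclear₃_R` is `20·K·sL ≥ 800·sL` against `2·XY + 5·sL + O(R′)`, so any `XY ≤ 396·sL` would do — `100·sL` is stated, to be
window-proof (at the tuple: `(XY_le_3 …).2` and `22·sL ≤ 100·sL`).  Same proof, verbatim, with the one constant changed; the second-axis `_of_le`
wrapper `NegB.rootLegAt_frmQ3KV_snd_of_le` reads this binder (`hXY`).
NON-VACUITY (lead g11 standing order): pure row arithmetic over the KGY rows of record + p5-g16's `Skelφ.clear_of_kgCorrSchedY_rows4`; hypotheses
= slot floors + two (C)-value rows, all discharged at the tuple by stmt's era-3 rows.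
builds on p205010 (kernel theorem, internal audit signed; external expert review pending) — nothing in this file uses p205010; nothing here is a
claim about the open node `SamePDropOfSkeletonFrm₁`.
Lane `prim-bschramm`, seat `prim-bschramm-p3` (gen 18; N2 design owner, (R) column owner); helper file (`--supports stmt-CriticalPhenomena-4575 --as helper`).
[cite: KozmaNitzan2024, §4 Lemma 11 (p. 22), Lemma 12 (pp. 23–25), p. 28 ((32) at the root)]
-/

noncomputable section

open scoped Classical

namespace Summit.CriticalPhenomena.PercolationContinuityZ3.Theorems.Transplant

namespace PlanarSkeletonFrm

namespace NegB

open Literature.Probability.Percolation Literature.Probability.LatticeModels SimpleGraph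
open SkelConc (Consts)
open Skelφ (rootFrame shearUnit kgSL kgSLY kgΔY kgNY KGYRows kgFarY kgXY kgM₁Y kgM₂Y)
open Neg

namespace KS

section ClearRW

variable (κ : Consts) {V : Type} [DecidableEq V] [Countable V] {G : SimpleGraph V} [G.LocallyFinite] (Φ : PlanarSkeletonFrm G) (t : V) (p : unitInterval)
  (D : Skelφ.StepI.DataNS V) (mk g f qxY WxY : ℕ)

/-- **THE SKELETON'S `hclear₃` (square-avoidance form of the V twin) AT THE (R-46) VALUES, WIDE-WINDOW ROW `XY ≤ 100·sL`**, for any planar map `ψ`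
and origin `c₂ = t + (X2R, Y2R)`: every region `k` of the root's y′-corridor misses the seed square of half-side `Rs`. [this work] -/
theorem hclear₃_RW (hN : EqNumL κ Φ t p D g f) (hg : gFloorKG κ Φ t p D mk ≤ g) (hg2 : 40 * Neg.K κ * KS0.R'0 κ Φ t p D mk ≤ g)
    (hgR : 60 * (KS.Rs t D mk + 1) ≤ g) (hWxY : KS.Rs t D mk + 34 * nL κ Φ t p D g f + 29 * KS0.R'0 κ Φ t p D mk + 2 ≤ WxY)
    (hqx20 : (qxY : ℤ) ≤ 20 * (kgSL (nL κ Φ t p D g f) (ℓL κ Φ t p D g f) (hL κ Φ t p D g f))) (h0 : (kgFarY (nL κ Φ t p D g f) (ℓL κ Φ t p D g f) (hL κ Φ t p D g f) (vL κ Φ t p D g f) (kgR κ Φ t p D mk) 0 (kgqY κ Φ t p D g f qxY) (kgWY κ Φ t p D g f WxY) 0) ≤ (kgTgtY0 κ Φ t p D g f mk)) (hXY : (kgXY (nL κ Φ t p D g f) (ℓL κ Φ t p D g f) (hL κ Φ t p D g f) (vL κ Φ t p D g f) (kgR κ Φ t p D mk) 0 (kgqY κ Φ t p D g f qxY) (kgWY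 κ Φ t p D g f WxY) (kgNYv0 κ Φ t p D g f mk qxY WxY)) ≤ 100 * (kgSL (nL κ Φ t p D g f) (ℓL κ Φ t p D g f) (hL κ Φ t p D g f)))
    {ψ : V → Site 2} {c₂ : V} (hX2 : ψ c₂ 0 - ψ t 0 = (((KS.X2R κ Φ t p D mk g f WxY) : ℕ) : ℤ)) (hY2 : ψ c₂ 1 - ψ t 1 = (KS.Y2R κ Φ t p D mk g f WxY)) :
    ∀ k ≤ (Skelφ.kgCorrSchedY (kgYRows0_of κ Φ t p D g f mk qxY (KS.WxYR κ Φ t p D mk g f WxY) hN hg).hn (kgYRows0_of κ Φ t p D g f mk qxY (KS.WxYR κ Φ t p D mk g f WxY) hN hg).hv (kgYRows0_of κ Φ t p D g f mk qxY (KS.WxYR κ Φ t p D mk g f WxY) hN hg).hlay ((kgYRows0_of κ Φ t p D g f mk qxY (KS.WxYR κ Φ t p D mk g f WxY) hN hg).kgYVals_ok₁ (kgNYv0 κ Φ t p D g f mk qxY WxY)) ((kgYRows0_of κ Φ t p D g f mk qxY (KS.WxYR κ Φ t p D mk g f WxY) hN hg).kgYVals_ok₂ (kgNYv0 κ Φ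 t p D g f mk qxY WxY)) ((kgYRows0_of κ Φ t p D g f mk qxY (KS.WxYR κ Φ t p D mk g f WxY) hN hg).kgYVals_split (kgNYv0 κ Φ t p D g f mk qxY WxY))).N, ∀ w : V, Skelφ.runX ψ c₂ (nL κ Φ t p D g f) (hL κ Φ t p D g f) 1 w ∈ (Skelφ.kgCorrSchedY (kgYRows0_of κ Φ t p D g f mk qxY (KS.WxYR κ Φ t p D mk g f WxY) hN hg).hn (kgYRows0_of κ Φ t p D g f mk qxY (KS.WxYR κ Φ t p D mk g f WxY) hN hg).hv (kgYRows0_of κ Φ t p D g f mk qxY (KS.WxYR κ Φ t p D mk g f WxY) hN hg).hlay ((kgYRows0_of κ Φ t p D g f mk qxY (KS.WxYR κ Φ t p D mk g f WxY) hN hg).kgYVals_ok₁ (kgNYv0 κ Φ t p D g f mk qxY WxY)) ((kgYRows0_of κ Φ t p D g f mk qxY (KS.WxYR κ Φ t p D mk g f WxY) hN hg).kgYVals_ok₂ (kgNYv0 κ Φ t p D g f mk qxY WxY)) ((kgYRows0_of κ Φ t p D g f mk qxY (KS.WxYR κ Φ t p D mk g f WxY) hN hg).kgYVals_split (kgNYv0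 κ Φ t p D g f mk qxY WxY))).region k →
      (((KS.Rs t D mk) : ℕ) : ℤ) < rootFrame ψ t 1 w 0 ∨ (((KS.Rs t D mk) : ℕ) : ℤ) < rootFrame ψ t 1 w 1 ∨
        rootFrame ψ t 1 w 0 < -(((KS.Rs t D mk) : ℕ) : ℤ) ∨ rootFrame ψ t 1 w 1 < -(((KS.Rs t D mk) : ℕ) : ℤ) := by
  have HC := (kgYRows0_of κ Φ t p D g f mk qxY WxY hN hg)
  have HR := (kgYRows0_of κ Φ t p D g f mk qxY (KS.WxYR κ Φ t p D mk g f WxY) hN hg)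
  obtain ⟨hn1, -⟩ := one_le_of_eqNumL κ Φ t p D g f hN
  obtain ⟨r2lo, -, -⟩ := rows_c₂_zero κ Φ t p D mk g f WxY hN
  have hXYn : (hL κ Φ t p D g f) * (((KS.X2R κ Φ t p D mk g f WxY) : ℕ) : ℤ) ≤ (nL κ Φ t p D g f : ℤ) * (KS.Y2R κ Φ t p D mk g f WxY) := by linarith
  have hxrow := hxrow_R κ Φ t p D mk g f WxY hN hWxY
  have hfloor := runFloorY_R κ Φ t p D mk g f qxY WxY hN hg h0
  have hpitch := pitchY_ge κ Φ t p D g f hN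
  -- floors
  obtain ⟨hKR, hKs, h958, hR1, hK, -⟩ := valsQ_floor κ Φ t p D g f mk hN hg hg2
  have hsL := ML_sub_one_le_kgSL κ Φ t p D g f hN
  have hgML : g ≤ ML κ Φ t p D g := (ML_le_ML κ Φ t p D g).2
  have hRs : 60 * ((((KS.Rs t D mk) : ℕ) : ℤ) + 1) ≤ (kgSL (nL κ Φ t p D g f) (ℓL κ Φ t p D g f) (hL κ Φ t p D g f)) + 1 := by
    have : ((60 * (KS.Rs t D mk + 1) : ℕ) : ℤ) ≤ ((ML κ Φ t p D g : ℕ) : ℤ) := by exact_mod_cast hgR.trans hgML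
    push_cast at this; linarith
  have hR0 : (0 : ℤ) ≤ (((kgR κ Φ t p D mk) : ℕ) : ℤ) := by positivity
  have eR : (kgR κ Φ t p D mk) = (KS0.R'0 κ Φ t p D mk) := rfl
  have h1600 : 1600 * (((kgR κ Φ t p D mk) : ℕ) : ℤ) ≤ (kgSL (nL κ Φ t p D g f) (ℓL κ Φ t p D g f) (hL κ Φ t p D g f)) + 1 := by rw [eR]; nlinarith
  have hU : 0 < shearUnit (nL κ Φ t p D g f) (hL κ Φ t p D g f) := by unfold Skelφ.shearUnit; omega
  have hP : ((((nL κ Φ t p D g f) * (ℓL κ Φ t p D g f) / shearUnit (nL κ Φ t p D g f) (hL κ Φ t p D g f) : ℕ)) : ℤ) ≤ (kgSLY (nL κ Φ t p D g f) (ℓL κ Φ t p D g f) (hL κ Φ t p D g f)) + 1 := Skelφ.natDiv_le_kgSLY hn1 (ℓL κ Φ t p D g f) (hL κ Φ t p D g f)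
  have eσ' : (kgSLY (nL κ Φ t p D g f) (ℓL κ Φ t p D g f) (hL κ Φ t p D g f)) = (kgSL (nL κ Φ t p D g f) (ℓL κ Φ t p D g f) (hL κ Φ t p D g f)) := rfl
  rw [eσ'] at hP
  have hL3 := Skelφ.natDiv_three_le ((nL κ Φ t p D g f) * (ℓL κ Φ t p D g f)) (shearUnit (nL κ Φ t p D g f) (hL κ Φ t p D g f)) hU
  have hL6 : (((3 * ((nL κ Φ t p D g f) * (ℓL κ Φ t p D g f)) / shearUnit (nL κ Φ t p D g f) (hL κ Φ t p D g f) + 1 : ℕ)) : ℤ) ≤ 3 * (kgSL (nL κ Φ t p D g f) (ℓL κ Φ t p D g f) (hL κ Φ t p D g f)) + 6 := by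
    have : ((3 * ((nL κ Φ t p D g f) * (ℓL κ Φ t p D g f)) / shearUnit (nL κ Φ t p D g f) (hL κ Φ t p D g f) : ℕ) : ℤ) ≤ 3 * ((((nL κ Φ t p D g f) * (ℓL κ Φ t p D g f) / shearUnit (nL κ Φ t p D g f) (hL κ Φ t p D g f) : ℕ)) : ℤ) + 2 := by exact_mod_cast hL3
    push_cast at this hP ⊢; linarith
  have hPe : ((((nL κ Φ t p D g f) * (ℓL κ Φ t p D g f) / shearUnit (nL κ Φ t p D g f) (hL κ Φ t p D g f) + 1 : ℕ)) : ℤ) ≤ (kgSL (nL κ Φ t p D g f) (ℓL κ Φ t p D g f) (hL κ Φ t p D g f)) + 2 := by push_cast at hP ⊢; linarith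
  have hq : (((kgqY κ Φ t p D g f qxY) : ℕ) : ℤ) = ((((nL κ Φ t p D g f) * (ℓL κ Φ t p D g f) / shearUnit (nL κ Φ t p D g f) (hL κ Φ t p D g f) + 1 : ℕ)) : ℤ) + qxY := by unfold kgqY; push_cast; ring
  have hPe' : ((nL κ Φ t p D g f : ℤ)) * ((((ℓL κ Φ t p D g f)) : ℕ) : ℤ) / ((shearUnit (nL κ Φ t p D g f) (hL κ Φ t p D g f) : ℕ) : ℤ) + 1 ≤ (kgSL (nL κ Φ t p D g f) (ℓL κ Φ t p D g f) (hL κ Φ t p D g f)) + 2 := by push_cast at hP ⊢; linarith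
  have eσ : ((((nL κ Φ t p D g f) : ℤ) * (ℓL κ Φ t p D g f) - (shearUnit (nL κ Φ t p D g f) (hL κ Φ t p D g f) : ℕ) + 1) / (shearUnit (nL κ Φ t p D g f) (hL κ Φ t p D g f) : ℕ)) = (kgSL (nL κ Φ t p D g f) (ℓL κ Φ t p D g f) (hL κ Φ t p D g f)) := rfl
  have hΔ : kgΔY (kgR κ Φ t p D mk) 0 = 3 * (((kgR κ Φ t p D mk) : ℕ) : ℤ) + 2 * ((0 : ℕ) : ℤ) + 2 := rfl
  have htgt : pitchY κ Φ t p D g f ≤ (kgTgtY0 κ Φ t p D g f mk) := by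
    have hPn : (0 : ℤ) ≤ ((((nL κ Φ t p D g f) * (ℓL κ Φ t p D g f) / shearUnit (nL κ Φ t p D g f) (hL κ Φ t p D g f) : ℕ)) : ℤ) := by positivity
    have a1 : (0 : ℤ) ≤ (((((nL κ Φ t p D g f) * (ℓL κ Φ t p D g f) / shearUnit (nL κ Φ t p D g f) (hL κ Φ t p D g f) + 1 : ℕ)) : ℤ) - 1) / 2 := Int.ediv_nonneg (by push_cast at hPn ⊢; linarith) (by norm_num)
    have hΔ0 : (0 : ℤ) ≤ kgΔY (kgR κ Φ t p D mk) 0 := by unfold kgΔY; positivity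
    have hsY0 : (0 : ℤ) ≤ (kgSLY (nL κ Φ t p D g f) (ℓL κ Φ t p D g f) (hL κ Φ t p D g f)) := by rw [eσ']; linarith
    have a2 : (0 : ℤ) ≤ ((kgSLY (nL κ Φ t p D g f) (ℓL κ Φ t p D g f) (hL κ Φ t p D g f)) + kgΔY (kgR κ Φ t p D mk) 0) / 2 := Int.ediv_nonneg (by linarith) (by norm_num)
    unfold kgTgtY0
    linarith
  have hm₁0 : (0 : ℤ) ≤ ((((kgM₁Y (nL κ Φ t p D g f) (vL κ Φ t p D g f) (kgR κ Φ t p D mk) 0 (kgWY κ Φ t p D g f (KS.WxYR κ Φ t p D mk g f WxY)) (kgNYv0 κ Φ t p D g f mk qxY WxY))) : ℕ) : ℤ) := by positivity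
  have hN0 : (0 : ℤ) ≤ (((kgNYv0 κ Φ t p D g f mk qxY WxY) : ℕ) : ℤ) := by positivity
  have hs0 : (0 : ℤ) ≤ (kgSL (nL κ Φ t p D g f) (ℓL κ Φ t p D g f) (hL κ Φ t p D g f)) := by linarith
  have h800 : 800 * (kgSL (nL κ Φ t p D g f) (ℓL κ Φ t p D g f) (hL κ Φ t p D g f)) ≤ 20 * (Neg.K κ : ℤ) * (kgSL (nL κ Φ t p D g f) (ℓL κ Φ t p D g f) (hL κ Φ t p D g f)) := mul_le_mul_of_nonneg_right (by linarith) hs0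
  rw [hΔ, eσ'] at hfloor
  simp only [Nat.cast_zero, mul_zero, add_zero] at hfloor
  refine Skelφ.clear_of_kgCorrSchedY_rows4 HR.hn HR.hv HR.hlay (HR.kgYVals_ok₁ (kgNYv0 κ Φ t p D g f mk qxY WxY)) (HR.kgYVals_ok₂ (kgNYv0 κ Φ t p D g f mk qxY WxY)) (HR.kgYVals_split (kgNYv0 κ Φ t p D g f mk qxY WxY))
    t c₂ hX2 hY2 hXYn 28 ?_ ?_ ?_ ?_
  · intro k hk
    exact hxrow k hk
  · intro k hk1 _hk2
    rw [eσ, hq]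
    have hk29 : (29 : ℤ) ≤ k := by exact_mod_cast hk1
    have hsR : (0 : ℤ) ≤ (kgSL (nL κ Φ t p D g f) (ℓL κ Φ t p D g f) (hL κ Φ t p D g f)) - (((kgR κ Φ t p D mk) : ℕ) : ℤ) := by linarith
    have hprod : 29 * ((kgSL (nL κ Φ t p D g f) (ℓL κ Φ t p D g f) (hL κ Φ t p D g f)) - (((kgR κ Φ t p D mk) : ℕ) : ℤ)) ≤ (k : ℤ) * ((kgSL (nL κ Φ t p D g f) (ℓL κ Φ t p D g f) (hL κ Φ t p D g f)) - (((kgR κ Φ t p D mk) : ℕ) : ℤ)) := mul_le_mul_of_nonneg_right hk29 hsR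
    linarith only [hprod, hPe, hqx20, hL6, hRs, h1600, h958, hR0]
  · intro j hj
    rw [eσ]
    simp only [Nat.cast_zero, add_zero]
    have hj' : (j : ℤ) ≤ ((((kgM₁Y (nL κ Φ t p D g f) (vL κ Φ t p D g f) (kgR κ Φ t p D mk) 0 (kgWY κ Φ t p D g f (KS.WxYR κ Φ t p D mk g f WxY)) (kgNYv0 κ Φ t p D g f mk qxY WxY))) : ℕ) : ℤ) + 1 := by
      have : (j : ℤ) ≤ ((((kgM₁Y (nL κ Φ t p D g f) (vL κ Φ t p D g f) (kgR κ Φ t p D mk) 0 (kgWY κ Φ t p D g f (KS.WxYR κ Φ t p D mk g f WxY)) (kgNYv0 κ Φ t p D g f mk qxY WxY))) : ℕ) : ℤ) := by exact_mod_cast hj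
      linarith
    have hjR : (j : ℤ) * (((kgR κ Φ t p D mk) : ℕ) : ℤ) ≤ (((((kgM₁Y (nL κ Φ t p D g f) (vL κ Φ t p D g f) (kgR κ Φ t p D mk) 0 (kgWY κ Φ t p D g f (KS.WxYR κ Φ t p D mk g f WxY)) (kgNYv0 κ Φ t p D g f mk qxY WxY))) : ℕ) : ℤ) + 1) * (((kgR κ Φ t p D mk) : ℕ) : ℤ) := mul_le_mul_of_nonneg_right hj' hR0
    linarith only [hfloor, hjR, htgt, hpitch, h800, hXY, hL6, hRs, h1600, h958, hR0]
  · rw [eσ]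
    simp only [Nat.cast_zero, add_zero]
    linarith only [hfloor, htgt, hpitch, h800, hXY, hL6, hPe', hRs, h1600, h958, hR0, hm₁0]

end ClearRW

end KS

end NegB

end PlanarSkeletonFrm

end Summit.CriticalPhenomena.PercolationContinuityZ3.Theorems.Transplant

end
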